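import Summits.Ventures.CertifiedManyBodySolver.Theorems.M3x2EdgeSplitSymReplayShardsA
import HarnessLib

/-!
# SymReplay — SHARDED (multi-call) replay of a word-form certificate and its soundness (T12b; hub-lb-sym-eng-3)

For certificates whose identity check does not fit one farm call (E₁-class: ≈ 10⁸·⁵ word products), the
expensive part — the pair expansion of the matrix-form Gram blocks — is split into SHARDS: the base shard
`LHS − (RHS without the Gram blocks)` and, per block, chunks of `c+1` basis rows of its pair expansion (`shardPolys K c`).
Farm call `j` proves `shardOK K c j P_j = true` (one `native_decide`: `P_j` supported in the frame and
`canonNF K.frame (shard j) − P_j ≡ 0`, `canonNF` = normal-order ∘ collect ∘ anchored canonicalisation), one more call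
proves `isZero (canonNF K.frame (P_0 ++ … ++ P_m)) = true`, and `wardD4CertGe_of_shards` assembles them through the
expansion-form soundness `wardD4CertGe_of_expansion` (T12a): the statement of each per-call theorem is the only object
crossing a call boundary (hub-lb-sym-plan-2's `ShardSum` design, instantiated on the landed checker).
No summit or crux statement is proved here; no certificate beyond toys is replayed; nothing here predicts superconductivity.
-/

noncomputable section

namespace Summit.Ventures.CertifiedManyBodySolver.Theorems.SymReplay

open Matrix Finset
open Literature.MathematicalPhysics.QuantumLattice
open Literature.MathematicalPhysics.QuantumLattice.HubbardWave0
open Literature.MathematicalPhysics.QuantumLattice.ThermodynamicLimit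
open Literature.Probability.LatticeModels
open Literature.MathematicalPhysics.QuantumManyBody.StateRelaxation
open Summit.Ventures.CertifiedManyBodySolver.Theorems.WardSlot
open scoped ComplexOrder BigOperators

/-! ##### The per-shard pipe and its expansion into identification uses -/

/-- The per-shard pipe: normal-order, collect, canonicalise termwise (anchored at the frame corner). -/
def canonNF (frame : List (Site 2)) (p : QPoly) : QPoly :=
  (collect (nfPoly p)).flatMap (canonTermA (flatSite (minCorner frame)) frame)

/-- The identification uses spent by `canonNF`. -/
def canonNFUses (frame : List (Site 2)) (p : QPoly) : List IdUse :=
  (collect (nfPoly p)).flatMap (usesOfTerm (flatSite (minCorner frame)) frame)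

/-- `p ≡ canonNF p` up to its identification uses (as operators, for `p` supported in `Λ' ⊇ frame`). -/
theorem canonNF_expansion {Λ' : Finset (Site 2)} (frame : List (Site 2)) (hfr : frame.toFinset ⊆ Λ') (p : QPoly)
    (hp : PSupp p Λ') :
    polyOp Λ' p = polyOp Λ' (canonNF frame p) + ((canonNFUses frame p).map (useOp Λ')).sum := by
  have h := sum_canonTerm stub_nfFaithful (flatSite (minCorner frame)) frame hfr (collect (nfPoly p))
  have hc : polyOp Λ' (collect (nfPoly p)) = polyOp Λ' p := by
    rw [polyOp_eq_evalP, collect_eval, ← polyOp_eq_evalP, polyOp_nfPoly stub_nfFaithful _ _ hp]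
  rw [canonNF, canonNFUses, ← h, hc]
  abel

/-- The words of the uses of `canonNF p` are words of `p`'s normal form, hence supported with `p`. -/
theorem canonNFUses_supp (frame : List (Site 2)) (p : QPoly) {Λ : Finset (Site 2)} (hp : PSupp p Λ) :
    ∀ e ∈ canonNFUses frame p, SuppIn e.u Λ := by
  intro e he
  rw [canonNFUses, List.mem_flatMap] at he
  obtain ⟨t, ht, he⟩ := he
  rw [(usesOfTerm_spec e he).1]
  exact hp.nfPoly.collect t ht

/-! ##### Shards: the base shard and the row chunks of every Gram block -/

/-- Fuel-structural chunking of a list into pieces of `c + 1` elements (the last possibly shorter). -/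
def chunksOf {α : Type*} (c : ℕ) : ℕ → List α → List (List α)
  | 0, l => if l.isEmpty then [] else [l]
  | f + 1, l => if l.isEmpty then [] else l.take (c + 1) :: chunksOf c f (l.drop (c + 1))

/-- Chunking loses nothing (at any fuel). -/
theorem flatten_chunksOf {α : Type*} (c : ℕ) : ∀ (f : ℕ) (l : List α), (chunksOf c f l).flatten = l
  | 0, l => by
    unfold chunksOf
    split_ifs with h
    · rw [List.isEmpty_iff] at h; rw [h]; rfl
    · simp
  | f + 1, l => by
    unfold chunksOf
    split_ifs with h
    · rw [List.isEmpty_iff] at h; rw [h]; rfl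
    · rw [List.flatten_cons, flatten_chunksOf c f, List.take_append_drop]

/-- The pair-expansion rows of a block restricted to a chunk of its `(q_i, L_i)` list. -/
def blockRowsPoly (B : GramBlock) (ch : List (QPoly × List (ℚ × ℕ))) : QPoly :=
  ch.flatMap fun a => (blockPairs B).flatMap fun b =>
    let g := sdot a.2 b.2
    if g = 0 then [] else pscale g (pmul (padj a.1) b.1)

/-- The shards of one block: `(−scale) • (rows of a chunk)` per chunk of `c + 1` basis elements. -/
def blockShardPolys (c : ℕ) (B : GramBlock) : List QPoly :=
  (chunksOf c (blockPairs B).length (blockPairs B)).map fun ch => pscale (-B.scale) (blockRowsPoly B ch)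

/-- The matrix-form Gram block is `scale •` the rows of the full pair list. -/
theorem gramBlockPoly_eq (B : GramBlock) : gramBlockPoly B = pscale B.scale (blockRowsPoly B (blockPairs B)) := rfl

/-- `blockRowsPoly` is additive in the chunk. -/
theorem polyOp_blockRowsPoly_flatten (Λ' : Finset (Site 2)) (B : GramBlock) :
    ∀ (chs : List (List (QPoly × List (ℚ × ℕ)))),
      polyOp Λ' (blockRowsPoly B chs.flatten) = (chs.map fun ch => polyOp Λ' (blockRowsPoly B ch)).sum
  | [] => by simp [blockRowsPoly]
  | ch :: chs => by
    rw [List.flatten_cons, List.map_cons, List.sum_cons, ← polyOp_blockRowsPoly_flatten Λ' B chs, ← polyOp_append]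
    rw [blockRowsPoly, blockRowsPoly, blockRowsPoly, List.flatMap_append]

/-- Pulling a common `−s •` out of a list sum of `polyOp`s. -/
theorem sum_map_pscale_neg (Λ' : Finset (Site 2)) (s : ℚ) :
    ∀ (l : List QPoly), ((l.map fun p => pscale (-s) p).map (polyOp Λ')).sum = -(((s : ℚ) : ℂ) • (l.map (polyOp Λ')).sum)
  | [] => by simp
  | p :: l => by
    rw [List.map_cons, List.map_cons, List.sum_cons, sum_map_pscale_neg Λ' s l, List.map_cons, List.sum_cons,
      polyOp_pscale, Rat.cast_neg, neg_smul, smul_add, neg_add]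

/-- The shards of a block sum to MINUS the block. -/
theorem sum_blockShardPolys (Λ' : Finset (Site 2)) (c : ℕ) (B : GramBlock) :
    ((blockShardPolys c B).map (polyOp Λ')).sum = -polyOp Λ' (gramBlockPoly B) := by
  have h := polyOp_blockRowsPoly_flatten Λ' B (chunksOf c (blockPairs B).length (blockPairs B))
  rw [flatten_chunksOf] at h
  rw [gramBlockPoly_eq, polyOp_pscale, h, blockShardPolys]
  have e : (List.map (fun ch => pscale (-B.scale) (blockRowsPoly B ch))
      (chunksOf c (blockPairs B).length (blockPairs B))) =
      ((chunksOf c (blockPairs B).length (blockPairs B)).map (blockRowsPoly B)).map (fun p => pscale (-B.scale) p) := by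
    rw [List.map_map]; rfl
  rw [e, sum_map_pscale_neg, List.map_map]
  rfl

/-- RHS without the matrix-form Gram blocks (the eight other families, in `rhsPoly`'s order). -/
def rhsNonBlock (K : SymCert) : QPoly :=
  (K.gram.flatMap fun g => pscale g.1 (pmul (padj g.2) g.2)) ++
    (K.eom.flatMap fun B => comm (hamPoly K.frame) B) ++
    (K.moves.flatMap fun mv => [(mv.z, moveWord mv.γ mv.v mv.u), (-mv.z, mv.u)]) ++
    K.charged ++
    (K.wardP.flatMap fun X => comm (spinPlusPoly K.frame) X) ++
    (K.wardM.flatMap fun X => comm (spinMinusPoly K.frame) X) ++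
    (K.antiH.flatMap fun t => pscale t.1 (psub (padj t.2) t.2)) ++
    K.slack

/-- `RHS = (RHS without blocks) + blocks`, as operators. -/
theorem polyOp_rhsPoly_split (Λ' : Finset (Site 2)) (K : SymCert) :
    polyOp Λ' (rhsPoly K) = polyOp Λ' (rhsNonBlock K) + polyOp Λ' (K.gramM.flatMap gramBlockPoly) := by
  simp only [rhsPoly, rhsNonBlock, polyOp_append]
  abel

/-- The base shard: `LHS − (RHS without the Gram blocks)`. -/
def baseShard (K : SymCert) : QPoly := psub (lhsPoly K) (rhsNonBlock K)

/-- **All shards**: the base shard, then every block's row-chunk shards (chunks of `c + 1` basis rows). -/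
def shardPolys (K : SymCert) (c : ℕ) : List QPoly := baseShard K :: K.gramM.flatMap (blockShardPolys c)

/-- The shards of a list of blocks sum to minus the blocks. -/
theorem sum_flatMap_blockShardPolys (Λ' : Finset (Site 2)) (c : ℕ) :
    ∀ (Bs : List GramBlock),
      ((Bs.flatMap (blockShardPolys c)).map (polyOp Λ')).sum = -polyOp Λ' (Bs.flatMap gramBlockPoly)
  | [] => by simp
  | B :: Bs => by
    rw [List.flatMap_cons, List.map_append, List.sum_append, sum_blockShardPolys, sum_flatMap_blockShardPolys Λ' c Bs,
      List.flatMap_cons, polyOp_append, neg_add]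

/-- **The shards sum to `LHS − RHS`.** -/
theorem sum_shardPolys (Λ' : Finset (Site 2)) (K : SymCert) (c : ℕ) :
    ((shardPolys K c).map (polyOp Λ')).sum = polyOp Λ' (lhsPoly K) - polyOp Λ' (rhsPoly K) := by
  rw [shardPolys, List.map_cons, List.sum_cons, sum_flatMap_blockShardPolys, baseShard, polyOp_psub,
    polyOp_rhsPoly_split]
  abel

/-- The `j`-th shard (`[]` past the end). -/
def shardPolyAt (K : SymCert) (c j : ℕ) : QPoly := ((shardPolys K c)[j]?).getD []

/-- **What ONE farm call proves about shard `j`** against its shipped partial `P`: `P` is supported in the frame and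
`canonNF (shard j) − P` collects to zero. -/
def shardOK (K : SymCert) (c j : ℕ) (P : QPoly) : Bool :=
  psuppIn P K.frame && isZero (psub (canonNF K.frame (shardPolyAt K c j)) P)

/-- **The per-call facts for shards `j, j+1, …` against the partials `Ps`** — structural on the literal list `Ps`, so
`⟨shard₀, shard₁, …, trivial⟩` typechecks WITHOUT evaluating the certificate. -/
def ShardFacts (K : SymCert) (c : ℕ) : ℕ → List QPoly → Prop
  | _, [] => True
  | j, P :: Ps => shardOK K c j P = true ∧ ShardFacts K c (j + 1) Ps

/-- The same facts as a two-list recursion (internal). -/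
def Facts₂ (K : SymCert) : List QPoly → List QPoly → Prop
  | [], [] => True
  | Q :: Qs, P :: Ps => (psuppIn P K.frame && isZero (psub (canonNF K.frame Q) P)) = true ∧ Facts₂ K Qs Ps
  | _, _ => False

/-- Index-based shard facts give the two-list facts on the corresponding suffix of `shardPolys`. -/
theorem facts₂_of_shardFacts (K : SymCert) (c : ℕ) :
    ∀ (Ps : List QPoly) (j : ℕ), ((shardPolys K c).drop j).length = Ps.length →
      ShardFacts K c j Ps → Facts₂ K ((shardPolys K c).drop j) Ps
  | [], j, hl, _ => by
    rw [List.length_nil, List.length_eq_zero_iff] at hl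
    rw [hl]; trivial
  | P :: Ps, j, hl, hf => by
    have hj : j < (shardPolys K c).length := by
      rw [List.length_drop, List.length_cons] at hl; omega
    rw [List.drop_eq_getElem_cons hj]
    have hQ : shardPolyAt K c j = (shardPolys K c)[j] := by
      rw [shardPolyAt, List.getElem?_eq_getElem hj]; rfl
    refine ⟨?_, facts₂_of_shardFacts K c Ps (j + 1) ?_ hf.2⟩
    · rw [← hQ]; exact hf.1
    · have := hl; rw [List.drop_eq_getElem_cons hj, List.length_cons, List.length_cons] at this; omega

/-- **Assembly of the per-shard facts**: the shards sum, as operators in any frame `Λ' ⊇ frame`, to the shipped partials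
plus the identification uses of the per-shard canonicalisations; the partials are supported in the frame. -/
theorem facts₂_sum {Λ' : Finset (Site 2)} (K : SymCert) (hFL : K.frame.toFinset ⊆ Λ') :
    ∀ (Qs Ps : List QPoly), Facts₂ K Qs Ps → (∀ Q ∈ Qs, PSupp Q K.frame.toFinset) →
      (Qs.map (polyOp Λ')).sum = polyOp Λ' Ps.flatten + ((Qs.flatMap (canonNFUses K.frame)).map (useOp Λ')).sum ∧
        PSupp Ps.flatten K.frame.toFinset
  | [], [], _, _ => by simp [PSupp]
  | [], _ :: _, h, _ => absurd h (by simp [Facts₂])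
  | _ :: _, [], h, _ => absurd h (by simp [Facts₂])
  | Q :: Qs, P :: Ps, h, hQ => by
    obtain ⟨h1, h2⟩ := h
    rw [Bool.and_eq_true] at h1
    obtain ⟨hP, hz⟩ := h1
    have hPs := PSupp_of_psuppIn hP
    obtain ⟨ih, ihs⟩ := facts₂_sum K hFL Qs Ps h2 (fun Q' hQ' => hQ Q' (List.mem_cons_of_mem _ hQ'))
    have hQF : PSupp Q K.frame.toFinset := hQ Q List.mem_cons_self
    have hcanon := canonNF_expansion K.frame hFL Q (hQF.mono hFL)
    have hzero := polyOp_eq_zero_of_isZero Λ' _ hz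
    rw [polyOp_psub, sub_eq_zero] at hzero
    refine ⟨?_, hPs.append ihs⟩
    rw [List.map_cons, List.sum_cons, List.flatten_cons, polyOp_append, List.flatMap_cons, List.map_append,
      List.sum_append, ih, hcanon, hzero]
    abel

/-! ##### Supports of the shards (from `wellFormed`) -/

/-- Words of a row chunk of a block lie where the basis does. -/
theorem PSupp_blockRowsPoly (B : GramBlock) {Λ : Finset (Site 2)} (hq : ∀ q ∈ B.basis, PSupp q Λ)
    (ch : List (QPoly × List (ℚ × ℕ))) (hch : ∀ a ∈ ch, a ∈ blockPairs B) : PSupp (blockRowsPoly B ch) Λ := by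
  refine PSupp.flatMap _ _ fun a ha => PSupp.flatMap _ _ fun b hb => ?_
  have ha' : PSupp a.1 Λ := hq _ (List.of_mem_zip (hch a ha)).1
  have hb' : PSupp b.1 Λ := hq _ (List.of_mem_zip hb).1
  dsimp only
  split_ifs
  · exact PSupp_nil _
  · exact (ha'.padj.pmul hb').pscale _

/-- Words of every block shard lie where the basis does. -/
theorem PSupp_blockShardPolys (c : ℕ) (B : GramBlock) {Λ : Finset (Site 2)} (hq : ∀ q ∈ B.basis, PSupp q Λ) :
    ∀ Q ∈ blockShardPolys c B, PSupp Q Λ := by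
  intro Q hQ
  rw [blockShardPolys, List.mem_map] at hQ
  obtain ⟨ch, hch, rfl⟩ := hQ
  refine (PSupp_blockRowsPoly B hq ch fun a ha => ?_).pscale _
  rw [← flatten_chunksOf c (blockPairs B).length (blockPairs B), List.mem_flatten]
  exact ⟨ch, hch, ha⟩

/-- The non-block part of the RHS is supported in the frame (from the `wellFormed` clauses). -/
theorem PSupp_rhsNonBlock (K : SymCert)
    (hg : ∀ g ∈ K.gram, psuppIn g.2 K.frame = true) (he : ∀ B ∈ K.eom, psuppIn B K.inner = true)
    (hIF : subSites K.inner K.frame = true)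
    (hm : ∀ mv ∈ K.moves, suppIn mv.u K.frame = true ∧ suppIn (moveWordF mv.γ mv.v mv.u) K.frame = true)
    (hc : ∀ t ∈ K.charged, suppIn t.2 K.frame = true) (hp : ∀ X ∈ K.wardP, psuppIn X K.frame = true)
    (hm' : ∀ X ∈ K.wardM, psuppIn X K.frame = true) (ha : ∀ t ∈ K.antiH, psuppIn t.2 K.frame = true)
    (hs : ∀ t ∈ K.slack, suppIn t.2 K.frame = true) :
    PSupp (rhsNonBlock K) K.frame.toFinset := by
  have hIF' : K.inner.toFinset ⊆ K.frame.toFinset := fun x hx =>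
    List.mem_toFinset.2 ((subSites_iff _ _).1 hIF x (List.mem_toFinset.1 hx))
  refine PSupp.append ?_ (fun t ht => SuppIn_of_suppIn (hs t ht))
  refine PSupp.append ?_ (PSupp.flatMap _ _ fun t ht => ((PSupp_of_psuppIn (ha t ht)).padj.psub
    (PSupp_of_psuppIn (ha t ht))).pscale _)
  refine PSupp.append ?_ (PSupp.flatMap _ _ fun X hX =>
    (PSupp_spinMinusPoly K.frame).comm (PSupp_of_psuppIn (hm' X hX)))
  refine PSupp.append ?_ (PSupp.flatMap _ _ fun X hX =>
    (PSupp_spinPlusPoly K.frame).comm (PSupp_of_psuppIn (hp X hX)))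
  refine PSupp.append ?_ (fun t ht => SuppIn_of_suppIn (hc t ht))
  refine PSupp.append ?_ (PSupp.flatMap _ _ fun mv hmv => ?_)
  · refine PSupp.append ?_ (PSupp.flatMap _ _ fun B hB => (PSupp_hamPoly K.frame).comm
      ((PSupp_of_psuppIn (he B hB)).mono hIF'))
    exact PSupp.flatMap _ _ fun g hg' => ((PSupp_of_psuppIn (hg g hg')).padj.pmul
      (PSupp_of_psuppIn (hg g hg'))).pscale _
  · intro t ht
    simp only [List.mem_cons, List.not_mem_nil, or_false] at ht
    rcases ht with rfl | rfl
    · rw [← moveWordF_eq]; exact SuppIn_of_suppIn (hm mv hmv).2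
    · exact SuppIn_of_suppIn (hm mv hmv).1

/-! ##### The sharded-replay soundness theorem -/

/-- **SHARDED REPLAY IS SOUND.**  For a well-formed `K`, a chunk size `c`, and shipped partials `Ps` (one per shard of
`shardPolys K c`): the per-call facts `ShardFacts K c 0 Ps` (each `shardOK K c j P_j = true` by ONE `native_decide`)
and the final fact `isZero (canonNF K.frame (P_0 ++ … ++ P_m)) = true` make `K` a Ward × affine-`D₄` window certificate of
value `symValue K`. -/
theorem wardD4CertGe_of_shards (K : SymCert) (hwf0 : wellFormed K = true) (c : ℕ) (Ps : List QPoly)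
    (hlen : (shardPolys K c).length = Ps.length) (hfacts : ShardFacts K c 0 Ps)
    (hfin : isZero (canonNF K.frame Ps.flatten) = true) : WardD4CertGe ((symValue K : ℚ) : ℝ) := by
  /- unpack the well-formedness clauses needed for the supports -/
  have hwf := hwf0
  simp only [wellFormed, Bool.and_eq_true] at hwf
  obtain ⟨⟨⟨⟨⟨⟨⟨⟨⟨⟨⟨⟨⟨-, hz0⟩, hn0⟩, hIF⟩, -⟩, hgram⟩, hgM⟩, heom⟩, hmov⟩, hch⟩, hwp⟩, hwm⟩, hah⟩, hsl⟩ := hwf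
  have hgram' : ∀ g ∈ K.gram, psuppIn g.2 K.frame = true := fun g hg => by
    have h := List.all_eq_true.1 hgram g hg
    rw [Bool.and_eq_true] at h
    exact h.2
  have hgM' : ∀ B ∈ K.gramM, ∀ q ∈ B.basis, PSupp q K.frame.toFinset := fun B hB q hq => by
    have h := List.all_eq_true.1 hgM B hB
    simp only [gramBlockOK, Bool.and_eq_true, List.all_eq_true] at h
    exact PSupp_of_psuppIn (h.2 q hq)
  have heom' : ∀ B ∈ K.eom, psuppIn B K.inner = true := fun B hB => List.all_eq_true.1 heom B hB
  have hmov' : ∀ mv ∈ K.moves, suppIn mv.u K.frame = true ∧ suppIn (moveWordF mv.γ mv.v mv.u) K.frame = true :=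
    fun mv hmv => by
      have h := List.all_eq_true.1 hmov mv hmv
      rwa [Bool.and_eq_true] at h
  have hch' : ∀ t ∈ K.charged, suppIn t.2 K.frame = true := fun t ht => by
    have h := List.all_eq_true.1 hch t ht
    rw [Bool.and_eq_true] at h
    exact h.1
  have hwp' : ∀ X ∈ K.wardP, psuppIn X K.frame = true := fun X hX => List.all_eq_true.1 hwp X hX
  have hwm' : ∀ X ∈ K.wardM, psuppIn X K.frame = true := fun X hX => List.all_eq_true.1 hwm X hX
  have hah' : ∀ t ∈ K.antiH, psuppIn t.2 K.frame = true := fun t ht => List.all_eq_true.1 hah t ht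
  have hsl' : ∀ t ∈ K.slack, suppIn t.2 K.frame = true := fun t ht => List.all_eq_true.1 hsl t ht
  have h0F : thicken ({0} : Finset (Site 2)) 1 ⊆ K.frame.toFinset := by
    have h : subSites (thick [0]) K.frame = true := by simpa [thick] using hn0
    have h' := thicken_subset_of_thick h
    simpa using h'
  /- supports of all shards -/
  have hQ : ∀ Q ∈ shardPolys K c, PSupp Q K.frame.toFinset := by
    intro Q hQ
    rw [shardPolys, List.mem_cons] at hQ
    rcases hQ with rfl | hQ
    · exact (PSupp_lhsPoly K h0F).psub (PSupp_rhsNonBlock K hgram' heom' hIF hmov' hch' hwp' hwm' hah' hsl')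
    · rw [List.mem_flatMap] at hQ
      obtain ⟨B, hB, hQ⟩ := hQ
      exact PSupp_blockShardPolys c B (hgM' B hB) Q hQ
  /- the two-list facts and their sum -/
  have hF : Facts₂ K (shardPolys K c) Ps := by
    have h := facts₂_of_shardFacts K c Ps 0 (by rw [List.drop_zero]; exact hlen) hfacts
    rwa [List.drop_zero] at h
  /- the use list and the envelope -/
  let U := (shardPolys K c).flatMap (canonNFUses K.frame) ++ canonNFUses K.frame Ps.flatten
  have hL : (envelope K U).toList.toFinset = envelope K U := Finset.toList_toFinset _
  have hFL : K.frame.toFinset ⊆ (envelope K U).toList.toFinset := by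
    rw [hL]; exact (subset_thicken _ 1).trans (thicken_subset_envelope K U)
  obtain ⟨hsum, hPs⟩ := facts₂_sum K hFL (shardPolys K c) Ps hF hQ
  have hU : ∀ e ∈ U, SuppIn e.u K.frame.toFinset := by
    intro e he
    rcases List.mem_append.1 he with he | he
    · rw [List.mem_flatMap] at he
      obtain ⟨Q, hQ', he⟩ := he
      exact canonNFUses_supp K.frame Q (hQ Q hQ') e he
    · exact canonNFUses_supp K.frame _ hPs e he
  refine wardD4CertGe_of_expansion K hwf0 U hU ?_
  /- the expansion: LHS − RHS = Σ shards = Σ partials + shard uses, and Σ partials = final uses -/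
  have hfinal := canonNF_expansion K.frame hFL Ps.flatten (hPs.mono hFL)
  rw [polyOp_eq_zero_of_isZero _ _ hfin, zero_add] at hfinal
  rw [sum_shardPolys] at hsum
  rw [List.map_append, List.sum_append, ← hfinal, sub_eq_iff_eq_add.1 hsum]
  abel

/-- **Corollary**: a sharded certificate bounds the energy density. -/
theorem energyDensity_ge_of_shards (K : SymCert) (hwf : wellFormed K = true) (c : ℕ) (Ps : List QPoly)
    (hlen : (shardPolys K c).length = Ps.length) (hfacts : ShardFacts K c 0 Ps)
    (hfin : isZero (canonNF K.frame Ps.flatten) = true) :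
    ((symValue K : ℚ) : ℝ) ≤ energyDensityTT' 1 0 8 (7 / 8) :=
  energyDensity_ge_of_windowSound_cert _ WardSlot.stub_wardWindowSound (wardD4CertGe_of_shards K hwf c Ps hlen hfacts hfin)

/-- Kernel regression on the toys: `toyCert` has ONE shard (no Gram blocks); `toyCertM` (17 one-column blocks)
has `1 + 25` shards at chunk size `c = 0` (one per basis row). -/
example : (shardPolys toyCert 0).length = 1 ∧ (shardPolys toyCertM 0).length = 26 := by decide +kernel

end Summit.Ventures.CertifiedManyBodySolver.Theorems.SymReplay

end
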